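import Summits.ValiantsHypothesis.ValiantsHypothesis.Theorems.NcShapeAnticoncentration
import HarnessLib

/-!
# The few-shapes rung for the non-commutative permanent — F4 of O-L6-21

THE THEOREM (★★ `ncPerPoly_fewShapes`, ★ `perNotNcVP_fewShapes_eventually`; FLOS20 Theorem 23 /
LLS18 Theorem 13 in kernel form, parametric). A constant-free binary non-commutative circuit
computing `PERM_{2n}` (as `ncPerPoly`) whose parse trees of full degree `2n` have their SHAPES in a
list `L` with `|L|·(2n+1)·13^q < 16^q`, `q = ⌊2n/64g²⌋`, has size `≥ 2^g/(2n+1)²`. Schedule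
`2n = 256·g^(a+2)` (`q = 4g^a`): against circuits with at most `2^(g^a)/(2n+1) − 1` full-degree
shapes, `PERM_{2n}` needs size `> (2n)^c + c` for all large `g` — `a = 1`: `2^{Θ((2n)^{1/3})}`
shapes (LLS18 Theorem 13's `k`-PT range), `a → ∞`: `2^{(2n)^{1−2/(a+2)}}` shapes (FLOS20
Theorem 23's range).
PROOF. F3's union bound gives ONE balanced mask `Y` (`|Y| = n`) under which every shape of `L` of
size `2n` has a `g`-imbalanced internal node; a balanced mask has a complementing involution
(`exists_mate`); imbalance `≥ g` is `(n−g)`-good (`des_ivGood_ne_none`); the mask-agnostic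
consumer (`ncPerPoly_le_of_designation_of`, the proof of `ncPerPoly_le_of_designation` BY NAME with
the shape class `nsd ≤ k` replaced by an arbitrary class `T`) gives `2^n ≤ (2n+1)²·2^(n−g)·size`.
ROLE IN THE SERIES (O-L6-21, decomp-valiant lens 6): F1 `NcSignSmallBall` → F2 `NcShapeRings` →
F3 `NcShapeAnticoncentration` → F4 (this). BY NAME: `zeroConst_substIn`, `binary_substIn`,
`shapes_substIn` (NcPairingPermanent), `pairSubst`, `perm_pairing`, `degPart_pairPoly`,
`rank_flat_pairPoly` (NcPairingPolynomial), `hankel_interval_bound` (NcHankelIntervalBound),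
`ncEval_substIn` (NcCayleyDeterminant), `pow_lt_two_pow_eventually` (NcTypedPermanentEventually),
`exists_balanced_designating`, `des_ivGood_ne_none` (F3).
NON-VACUITY: the class is inhabited for every `|L| ≥ 1` — `L = [left comb]` with the `Σ_π` left-comb
circuit for `PERM_{2n}` (one full-degree shape; the UPT class is `L = [T]`). DEGENERATE `a = 0` in
the eventually form: the shape-count hypothesis `(|L|+1)(D+1) ≤ 2` is unsatisfiable (`D ≥ 256`),
so that case is vacuously true — harmless; content starts at `a = 1` (LLS18's range).
LABEL (critic g12, verbatim): «O-L6-21 (lens-6 g51): print-KNOWN THEOREM (FLOS20 Thm 23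
[corpus:paper:doi-10-4230-lipics-stacs-2020-20 p.17] = LLS18 Thm 13
[corpus:paper:doi-10-1007-s00037-018-0171-9 p.10] sharpened: superpolynomial lower bounds for PERM
against non-commutative circuits with FEW parse-tree SHAPES) · proof route OURS (ring certificate
at blob scale 16g² + Paley–Zygmund small ball by fourth-moment COUNTING + mixing over
complementary coordinates, replacing the fresh-leaf node sequence + central-binomial bound of
LLS18 Subclaim 16 / FLOS20 App.) · kernel-NEW · RUNG «few shapes» on the commutativity dial
(W15): beside (b) nsd ≤ k (INCOMPARABLE), above (a) UPT / rotation, strictly below (c) = A_nc ·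
restricted model · S-implied · WEAKER · 0 S-currency · closes / re-tags NO item · A_nc stmt-23446
OPEN · IDEA-NEEDED, NcLift stmt-23447, routes DecompCycle1 / TameSensitivity, VP ≠ VNP
untouched».
HONEST BOUNDARY (O-L6-21): a RUNG on the commutativity dial in a RESTRICTED MODEL — every
const-free binary non-commutative circuit computing PERM_{2n} (P.ncEval = ncPerPoly K (2n)) whose
FULL-DEGREE parse-tree SHAPES lie in a list L with |L|·(2n+1)·13^q < 16^q, q = ⌊2n/64g²⌋, g ≥ 1,
64g² ≤ 2n (FEW SHAPES; the UPT class is L = [T]; the class is INCOMPARABLE with non-skew depth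
≤ k) has size ≥ 2^g/(2n+1)²; eventually form on the schedule D = 256·g^(a+2): fewer than
2^(g^a)/(D+1) shapes force size > D^c + c (a = 1: 2^{Θ(D^{1/3})} shapes = LLS18 Thm 13's range;
a → ∞: 2^{D^{1−2/(a+2)}} = FLOS20 Thm 23's range); print-KNOWN in substance (FLOS20 Thm 23,
LLS18 Thm 13; constants ours), the anti-concentration lemma (FLOS20 Lemma 21 / LLS18 Claim 15) by
an OWN counting route (ring certificate + fourth-moment small ball + mixing); S-implied (S ⇒ A_nc
⇒ every restricted-model bound) · WEAKER than A_nc = CommutativityDial.PerNotNcVP (stmt-23446),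
which stays OPEN · UNDECIDED · IDEA-NEEDED — the one-mask method provably stops at
shape-restricted classes (every balanced mask is defeated at imbalance 2 by some shape);
0 S-currency; closes NO item; stmt-23446 / NcLift stmt-23447 / routes DecompCycle1 ·
TameSensitivity / VP ≠ VNP untouched.
[cite: FijalkowLagardeOhlmannSerre2020, Theorem 23, Lemma 21]
[cite: LagardeLimayeSrinivasan2018, Theorem 13, Claim 15] [cite: LimayeMalodSrinivasan2016, §6]
-/

noncomputable section

open Finset

namespace Summit.ValiantsHypothesis.ValiantsHypothesis.Theorems.NcFewShapesPermanent

set_option linter.dupNamespace false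
open Literature.Computability.AlgebraicComplexity
  Literature.Computability.AlgebraicComplexity.ArithCircuit
  Summit.ValiantsHypothesis.ValiantsHypothesis.Theorems.NcCentralWidth
  Summit.ValiantsHypothesis.ValiantsHypothesis.Theorems.NcUniqueParseTree
  Summit.ValiantsHypothesis.ValiantsHypothesis.Theorems.NcParseTrees
  Summit.ValiantsHypothesis.ValiantsHypothesis.Theorems.NcPartialDerivative
  Summit.ValiantsHypothesis.ValiantsHypothesis.Theorems.NcHankelIntervalModel
  Summit.ValiantsHypothesis.ValiantsHypothesis.Theorems.NcHankelIntervalBound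
  Summit.ValiantsHypothesis.ValiantsHypothesis.Theorems.NcCayleyDeterminant
  Summit.ValiantsHypothesis.ValiantsHypothesis.Theorems.NcTypedPermanentEventually
  Summit.ValiantsHypothesis.ValiantsHypothesis.Theorems.NcNonSkewDepthShapes
  Summit.ValiantsHypothesis.ValiantsHypothesis.Theorems.NcPairingPolynomial
  Summit.ValiantsHypothesis.ValiantsHypothesis.Theorems.NcPairingPermanent
  Summit.ValiantsHypothesis.ValiantsHypothesis.Theorems.NcSignSmallBall
  Summit.ValiantsHypothesis.ValiantsHypothesis.Theorems.NcShapeRings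
  Summit.ValiantsHypothesis.ValiantsHypothesis.Theorems.NcShapeAnticoncentration

universe u

variable (K : Type u) [Field K]

/-! ### §1 Mates and the consumer -/

/-- a balanced mask is exchanged with its complement by a pairing (an involution `mate`).
[cite: LimayeMalodSrinivasan2016, §6] [cite: FijalkowLagardeOhlmannSerre2020, Theorem 23] -/
theorem exists_mate {d : ℕ} (Y : Fin d → Bool)
    (h : Fintype.card {i : Fin d // Y i = true} = Fintype.card {i : Fin d // Y i = false}) :
    ∃ mate : Fin d → Fin d, (∀ c, mate (mate c) = c) ∧ ∀ c, Y (mate c) = !Y c := by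
  classical
  have e : {i : Fin d // Y i = true} ≃ {i : Fin d // Y i = false} := Fintype.equivOfCardEq h
  refine ⟨fun c => if hc : Y c = true then (e ⟨c, hc⟩).1
      else (e.symm ⟨c, eq_false_of_ne_true hc⟩).1, fun c => ?_, fun c => ?_⟩
  · by_cases hc : Y c = true
    · have h2 := (e ⟨c, hc⟩).2
      have h3 : ¬ Y (e ⟨c, hc⟩).1 = true := by rw [h2]; decide
      simp only [dif_pos hc, dif_neg h3]
      rw [show (⟨(e ⟨c, hc⟩).1, eq_false_of_ne_true h3⟩ : {i : Fin d // Y i = false}) =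
        e ⟨c, hc⟩ from Subtype.ext rfl, Equiv.symm_apply_apply]
    · have h2 := (e.symm ⟨c, eq_false_of_ne_true hc⟩).2
      simp only [dif_neg hc, dif_pos h2]
      rw [show (⟨(e.symm ⟨c, eq_false_of_ne_true hc⟩).1, h2⟩ : {i : Fin d // Y i = true}) =
        e.symm ⟨c, eq_false_of_ne_true hc⟩ from Subtype.ext rfl, Equiv.apply_symm_apply]
  · by_cases hc : Y c = true
    · have h2 := (e ⟨c, hc⟩).2
      dsimp only
      rw [dif_pos hc]
      simp only [h2, hc, Bool.not_true]
    · have h2 := (e.symm ⟨c, eq_false_of_ne_true hc⟩).2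
      dsimp only
      rw [dif_neg hc]
      simp only [h2, eq_false_of_ne_true hc, Bool.not_false]

/-- the mask-agnostic consumer for an ARBITRARY shape class `T` — same proof as
`ncPerPoly_le_of_designation` (NcPairingPermanent), class predicate generalised (`nsd · ≤ k` ↦ `T`).
[cite: FijalkowLagardeOhlmannSerre2020, Theorem 13, Theorem 20, Theorem 23]
[cite: LimayeMalodSrinivasan2016, §6] -/
theorem ncPerPoly_le_of_designation_of {D δ : ℕ} (T : Shape → Prop) (Y : Fin D → Bool)
    (mate : Fin D → Fin D) (hm : ∀ c, mate (mate c) = c) (hY : ∀ c, Y (mate c) = !Y c)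
    (hdes : ∀ S : Shape, S.size = D → T S → des (ivGood Y δ) S 0 ≠ none)
    (P : ArithCircuit K (Fin D × Fin D))
    (hc : ∀ g ∈ P.gates, ∀ u ∈ g.args, ∀ c, u ≠ Operand.const c)
    (hp : ∀ args, Gate.prod args ∈ P.gates → args.length = 1 ∨ args.length = 2)
    (ho : ∀ c, P.output ≠ Operand.const c) (hT : ∀ e ∈ circuitPts P, T e.1)
    (h : P.ncEval = ncPerPoly K D) :
    2 ^ Fintype.card {i : Fin D // Y i = true} ≤ (D + 1) ^ 2 * 2 ^ δ * P.size := by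
  have hfp : ∀ c, mate c ≠ c := fun c e => by
    have h1 := hY c
    rw [e] at h1
    exact (Bool.eq_not_self (Y c)).mp h1
  have hφ : ∀ x c, pairSubst K mate x = Sum.inr c → c = 0 := by
    intro x c hx
    unfold pairSubst at hx
    split_ifs at hx
    exact (Sum.inr.inj hx).symm
  obtain ⟨hcQ, hoQ⟩ := zeroConst_substIn K (pairSubst K mate) hφ P hc ho
  have hpQ := binary_substIn K (pairSubst K mate) P hp
  -- the substituted circuit's parse trees of size `D` are designated (shapes are preserved)
  have hdesQ : ∀ e ∈ circuitPts (P.substIn (pairSubst K mate)), e.1.size = D →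
      des (ivGood Y δ) e.1 0 ≠ none := by
    intro e he hsz
    obtain ⟨e', he', hee⟩ := shapes_substIn K (pairSubst K mate) P e he
    rw [← hee] at hsz ⊢
    exact hdes e'.1 hsz (hT e' he')
  have hle := hankel_interval_bound K (P.substIn (pairSubst K mate)) hcQ hpQ hoQ Y δ hdesQ
  rw [ncEval_substIn, h, perm_pairing, degPart_pairPoly K mate hfp,
    rank_flat_pairPoly K Y mate hm hY, Fintype.card_fin, size_substIn] at hle
  exact hle

/-! ### §2 The rung -/

/-- ★★ THE FEW-SHAPES RUNG (parametric): a const-free binary nc circuit computing `PERM_{2n}` whose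
parse trees of full degree `2n` have their shapes in a list `L` with
`|L|·(2n+1)·13^q < 16^q`, `q = ⌊2n/64g²⌋ ≥ 1`, has size `≥ 2^g/(2n+1)²`.
[cite: FijalkowLagardeOhlmannSerre2020, Theorem 23]
[cite: LagardeLimayeSrinivasan2018, Theorem 13] -/
theorem ncPerPoly_fewShapes {n g : ℕ} (hg : 1 ≤ g) (hn : 64 * g ^ 2 ≤ 2 * n) (L : List Shape)
    (hL : L.length * (2 * n + 1) * 13 ^ (2 * n / (64 * g ^ 2)) < 16 ^ (2 * n / (64 * g ^ 2)))
    (P : ArithCircuit K (Fin (2 * n) × Fin (2 * n)))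
    (hc : ∀ G ∈ P.gates, ∀ u ∈ G.args, ∀ c, u ≠ Operand.const c)
    (hp : ∀ args, Gate.prod args ∈ P.gates → args.length = 1 ∨ args.length = 2)
    (ho : ∀ c, P.output ≠ Operand.const c)
    (hT : ∀ e ∈ circuitPts P, e.1.size = 2 * n → e.1 ∈ L)
    (h : P.ncEval = ncPerPoly K (2 * n)) : 2 ^ g ≤ (2 * n + 1) ^ 2 * P.size := by
  -- the full-degree shapes of `L`
  set L' := L.filter (fun S => S.size = 2 * n) with hL'
  have hsz : ∀ S ∈ L', S.size = 2 * n := fun S hS => by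
    rw [hL', List.mem_filter] at hS
    simpa using hS.2
  have hlen : L'.length * (2 * n + 1) * 13 ^ (2 * n / (64 * g ^ 2)) <
      16 ^ (2 * n / (64 * g ^ 2)) :=
    (Nat.mul_le_mul_right _ (Nat.mul_le_mul_right _ (List.length_filter_le _ _))).trans_lt hL
  obtain ⟨Y, hY, hdes⟩ := exists_balanced_designating hg L' hsz hlen
  -- the complement of a balanced mask is balanced
  have hQ : Fintype.card {i : Fin (2 * n) // Y i = false} = n := by
    have s : Fintype.card {i : Fin (2 * n) // Y i = false} =
        Fintype.card {i : Fin (2 * n) // ¬Y i = true} :=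
      Fintype.card_congr (Equiv.subtypeEquivRight fun i => by rw [Bool.not_eq_true])
    rw [s, Fintype.card_subtype_compl, Fintype.card_fin, hY]
    omega
  obtain ⟨mate, hm, hYm⟩ := exists_mate Y (hY.trans hQ.symm)
  have hle := ncPerPoly_le_of_designation_of K (fun S => S.size = 2 * n → S ∈ L) Y mate hm hYm
    (fun S hS hSL => des_ivGood_ne_none Y (δ := n - g) (g := g) (by rw [hY]; omega)
      (by rw [hQ]; omega) S (hdes S (by
        rw [hL', List.mem_filter]
        exact ⟨hSL hS, by simpa using hS⟩))) P hc hp ho hT h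
  rw [hY] at hle
  have hgn : g ≤ n := by
    have := Nat.le_self_pow two_ne_zero g
    omega
  have hsub : g + (n - g) = n := by omega
  refine Nat.le_of_mul_le_mul_right ?_ (Nat.two_pow_pos (n - g))
  calc 2 ^ g * 2 ^ (n - g) = 2 ^ n := by rw [← pow_add, hsub]
    _ ≤ (2 * n + 1) ^ 2 * 2 ^ (n - g) * P.size := hle
    _ = (2 * n + 1) ^ 2 * P.size * 2 ^ (n - g) := by ring

/-- growth for the schedule `2n = 256·g^(a+2)`. [cite: LagardeLimayeSrinivasan2018, Theorem 13] -/
theorem growth256_eventually (a c : ℕ) : ∃ g₀ : ℕ, ∀ g, g₀ ≤ g →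
    (256 * g ^ (a + 2) + 1) ^ 2 * ((256 * g ^ (a + 2)) ^ c + c + 1) < 2 ^ g := by
  obtain ⟨N, hN⟩ := pow_lt_two_pow_eventually ((a + 2) * (c + 2) + 1)
  refine ⟨N + 8 * 256 ^ (c + 2) + 2, fun g hg => ?_⟩
  have hg1 : 1 ≤ g := by omega
  have hD : 2 ≤ 256 * g ^ (a + 2) := by
    have := Nat.one_le_pow (a + 2) g hg1
    omega
  have h2c : c < 2 ^ c := Nat.lt_two_pow_self
  have hc1 : c + 1 ≤ (256 * g ^ (a + 2)) ^ c :=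
    (Nat.succ_le_of_lt h2c).trans (Nat.pow_le_pow_left hD c)
  calc (256 * g ^ (a + 2) + 1) ^ 2 * ((256 * g ^ (a + 2)) ^ c + c + 1)
      ≤ (2 * (256 * g ^ (a + 2))) ^ 2 *
          ((256 * g ^ (a + 2)) ^ c + (256 * g ^ (a + 2)) ^ c) :=
        Nat.mul_le_mul (Nat.pow_le_pow_left (by omega) 2) (by omega)
    _ = 8 * 256 ^ (c + 2) * (g ^ (a + 2)) ^ (c + 2) := by ring
    _ = 8 * 256 ^ (c + 2) * g ^ ((a + 2) * (c + 2)) := by rw [← pow_mul]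
    _ ≤ g * g ^ ((a + 2) * (c + 2)) := Nat.mul_le_mul_right _ (by omega)
    _ = g ^ ((a + 2) * (c + 2) + 1) := by ring
    _ < 2 ^ g := hN g (by omega)

/-- ★ rung, eventually form, schedule `2n = 256·g^(a+2)` (`q = 4g^a`): against const-free binary
nc circuits with at most `2^(g^a)/(2n+1) − 1` full-degree parse-tree SHAPES, `PERM_{2n}` needs size
`> (2n)^c + c` for all large `g`. [cite: FijalkowLagardeOhlmannSerre2020, Theorem 23]
[cite: LagardeLimayeSrinivasan2018, Theorem 13] -/
theorem perNotNcVP_fewShapes_eventually (a c : ℕ) : ∃ g₀ : ℕ, ∀ g, g₀ ≤ g →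
    ∀ (P : ArithCircuit ℂ (Fin (2 * (128 * g ^ (a + 2))) × Fin (2 * (128 * g ^ (a + 2))))),
      (∀ G ∈ P.gates, ∀ u ∈ G.args, ∀ c, u ≠ Operand.const c) →
      (∀ args, Gate.prod args ∈ P.gates → args.length = 1 ∨ args.length = 2) →
      (∀ c, P.output ≠ Operand.const c) →
      ∀ L : List Shape, (L.length + 1) * (2 * (128 * g ^ (a + 2)) + 1) ≤ 2 ^ (g ^ a) →
      (∀ e ∈ circuitPts P, e.1.size = 2 * (128 * g ^ (a + 2)) → e.1 ∈ L) →
      P.ncEval = ncPerPoly ℂ (2 * (128 * g ^ (a + 2))) →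
      (2 * (128 * g ^ (a + 2))) ^ c + c < P.size := by
  obtain ⟨g₀, hg₀⟩ := growth256_eventually a c
  refine ⟨g₀ + 1, fun g hg P hc hp ho L hL hT h => ?_⟩
  have hg1 : 1 ≤ g := by omega
  have hga : 1 ≤ g ^ a := Nat.one_le_pow a g hg1
  have hg2 : 1 ≤ g ^ 2 := Nat.one_le_pow 2 g hg1
  -- `q = 4g^a` and `64g² ≤ 2n`
  have hq : 2 * (128 * g ^ (a + 2)) / (64 * g ^ 2) = 4 * g ^ a :=
    Nat.div_eq_of_eq_mul_left (by omega) (by ring)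
  have hn : 64 * g ^ 2 ≤ 2 * (128 * g ^ (a + 2)) := by
    have : g ^ 2 ≤ g ^ (a + 2) := Nat.pow_le_pow_right hg1 (by omega)
    omega
  -- the shape-count hypothesis in the rung's form: `|L|·(2n+1)·13^(4g^a) < 16^(4g^a)`
  have hL' : L.length * (2 * (128 * g ^ (a + 2)) + 1) *
      13 ^ (2 * (128 * g ^ (a + 2)) / (64 * g ^ 2)) <
      16 ^ (2 * (128 * g ^ (a + 2)) / (64 * g ^ 2)) := by
    rw [hq]
    have h1 : L.length * (2 * (128 * g ^ (a + 2)) + 1) < 2 ^ (g ^ a) :=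
      (Nat.mul_lt_mul_of_pos_right (Nat.lt_succ_self L.length) (Nat.succ_pos _)).trans_le hL
    have h2 : 2 ^ (g ^ a) * 13 ^ (4 * g ^ a) ≤ 16 ^ (4 * g ^ a) := by
      rw [pow_mul, pow_mul, ← mul_pow]
      exact Nat.pow_le_pow_left (by norm_num) _
    calc L.length * (2 * (128 * g ^ (a + 2)) + 1) * 13 ^ (4 * g ^ a)
        < 2 ^ (g ^ a) * 13 ^ (4 * g ^ a) :=
          Nat.mul_lt_mul_of_pos_right h1 (pow_pos (by norm_num) _)
      _ ≤ 16 ^ (4 * g ^ a) := h2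
  have hle := ncPerPoly_fewShapes ℂ hg1 hn L hL' P hc hp ho hT h
  have hlt := hg₀ g (by omega)
  have hA : 2 * (128 * g ^ (a + 2)) = 256 * g ^ (a + 2) := by ring
  rw [← hA] at hlt
  by_contra hcon
  have hS : P.size ≤ (2 * (128 * g ^ (a + 2))) ^ c + c := Nat.not_lt.1 hcon
  exact absurd hlt (Nat.not_lt.2 (hle.trans (Nat.mul_le_mul_left _ (by omega))))

end Summit.ValiantsHypothesis.ValiantsHypothesis.Theorems.NcFewShapesPermanent
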